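import Literature.Probability.Moments.NonnegativeLowerTail
import Summits.Ventures.LatticeQCDFlow.Scoring.ParityLegConfidence
import HarnessLib

/-!
# The parity leg from finitely many draws, III: variance-adaptive (self-bounding) radii —
# the weight level enters the certificate linearly

HONEST FRAMING: exact (Metropolis-corrected) sampling algorithms for lattice gauge theory;
figures of merit are autocorrelation/cost numbers at stated couplings and volumes; no
continuum-physics claim.

Venture `LatticeQCDFlow` (cell pub-lqcd), topic `Scoring`; FANOUT row 4 (`s0-u1-b`, rung S0-B:
two independent codes A, B for the 2D U(1) flow sampler, compared column by column).  Sequel of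
`Scoring/ParityLegConfidence.lean` / `ParityLegConfidenceColumns.lean` (same row), which certify the
masses of the parity-failure set `E` — the model mass `q(E)`, the target mass `π(E) = ∫_E w/Z`, the
squared-weight mass `∫_E p²/q` — from `n` independent MODEL draws with HOEFFDING radii: a score
`F ∈ [0, M]` with model mean `m = ∫ F q dμ` satisfies `m < F̄ + M·√(log(1/η)/(2n))` with confidence
`1 − η`.  Those files list as NOT CLAIMED 'Bernstein / empirical-variance radii'.  This file supplies
them.  The masses in question are SMALL (a parity failure is rare) while the weight LEVEL `M`
(`1`, `C/Z`, `W²`) is not, and Hoeffding's radius `M√(log(1/η)/(2n))` does not see that the score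
vanishes off `E`.  The right tool is the sub-Gaussian LOWER tail of nonnegative summands
(Maurer 2003 = Boucheron–Lugosi–Massart 2013 Exercise 2.9, tree:
`Literature.Probability.Moments.measureReal_sum_add_le_card_mul_le_exp_of_sq_le`): its variance
proxy is the raw second moment, and a score `F ∈ [0, M]` is SELF-BOUNDING, `E F² ≤ M·E F = M·m`.
The resulting oracle radius `√(2 M m log(1/η)/n)` depends on the unknown `m`; inverting the
quadratic gives an EMPIRICAL radius: with confidence `1 − e^{−na}`,
`m < F̄ + √(2 M a F̄) + 2 M a` — the weight level enters LINEARLY (`M a`, and under a square root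
against the small `F̄`), not as `M √a`.  NEW WORK of the cell (elementary); the one cited fact is
BLM 2013 Exercise 2.9 (proved in the tree); no definition is introduced.

## Setting (as in part I)

`(Ω, P)` a probability space carrying the draws; `(X, μ)` the configuration space; a model density
`q ≥ 0` (measurable); draws `x i : Ω → X`, `i ∈ ι`, INDEPENDENT (`iIndepFun x P`) with law
`P ∘ (x i)⁻¹ = μ.withDensity q` (`hlaw`); a measurable score `F : X → ℝ` with values in `[0, M]`,
model mean `m = ∫ F q dμ`; `s` a finite index set, `n = #s`, `F̄ = (Σ_{i∈s} F(xᵢ))/n`.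

## What is proved

* §1 (deterministic) `add_sqrt_mul_le_of_add_selfRadius_le` — for `c, m̂ ≥ 0`:
  `m̂ + √(2 c m̂) + 2c ≤ m ⇒ m̂ + √(2 c m) ≤ m` (the empirical event implies the oracle event);
  `lt_add_selfRadius_of_lt_add_sqrt_mul` — contrapositive: `m < m̂ + √(2cm) ⇒
  m < m̂ + √(2 c m̂) + 2c`.
* §2 **`measureReal_sum_comp_add_le_exp_of_model_draws_var`** — `F ∈ [0, M]`, `t ≥ 0`:
  `P(Σ_{i∈s} F(xᵢ) + n t ≤ n m) ≤ exp(−n t²/(2 M m))` (Hoeffding's `exp(−2nt²/M²)` has `M²`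
  where this has `4 M m`; `m ≤ M` always, `m ≪ M` for a failure score);
  **`measureReal_mean_add_selfRadius_le_exp_of_model_draws`** — `M > 0`, `a ≥ 0`, `n ≥ 1`:
  `P( F̄ + √(2 M a F̄) + 2 M a ≤ m ) ≤ e^{−na}` — `m < F̄ + √(2MaF̄) + 2Ma` with confidence
  `1 − e^{−na}`; at level `η` take `a = log(1/η)/n`.
* §3 the three instances — **`modelMass_le_freq_selfRadius_confidence`** (`F = 1_E`, `M = 1`:
  `P(N/n + √(2a·N/n) + 2a ≤ q(E)) ≤ e^{−na}`, `N` the failure count; and the oracle form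
  `modelMass_le_freq_confidence_var`: `P(N + nt ≤ n q(E)) ≤ exp(−nt²/(2q(E)))`),
  **`targetMass_le_weightedFreq_selfRadius_confidence`** (`F = 1_E·w/(Zq)`, `M = C/Z` under the
  ceiling `w ≤ Cq`: `P(Π̂/n + √(2(C/Z)a·Π̂/n) + 2(C/Z)a ≤ π(E)) ≤ e^{−na}`),
  **`sqWeightMass_le_weightedFreq_selfRadius_confidence`** (`F = 1_E(p/q)²`, `M = W²` under
  `p ≤ Wq`: `P(Σ̂/n + √(2W²a·Σ̂/n) + 2W²a ≤ ∫_E p²/q) ≤ e^{−na}`).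

The composed column certificates (acceptance, `τ_int`, ESS) with these radii are the sequel file
`Scoring/ParityLegBernsteinColumns.lean`.

Reading for row 4 (value-free; no number of ours, no sealed value): the parity leg's thresholds
shrink from `M√(log(1/η)/(2n))` to `√(2M p̂ log(1/η)/n) + 2M log(1/η)/n` per column (`M = 1`,
`C/Z`, `W²`), i.e. by a factor of order `√(p̂/M) + √(M log(1/η)/n)`-to-one when failures are rare,
at the same confidence and from the same draws; the composed `τ_int` / ESS thresholds of part II
improve by substituting these radii for `t` (their laws are monotone in the mass).  NOT CLAIMED:
optimality of the constants `2` (the sharp Bernoulli rate is the relative-entropy Chernoff bound);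
Bennett/Bernstein UPPER tails (not needed: only upper confidence bounds on masses enter); empirical
Bernstein with the sample variance; the chain (Markov) frame; estimating `δ`, `C`, `W`; any number
re-scored.
-/

noncomputable section

namespace Summit.Ventures.LatticeQCDFlow.Scoring.ParityLeg

open MeasureTheory ProbabilityTheory Finset Real Set

variable {Ω : Type*} [MeasurableSpace Ω] {P : Measure Ω} [IsProbabilityMeasure P] {ι : Type*}
variable {X : Type*} [MeasurableSpace X] {μ : Measure X}

/-! ## §1 The self-bounding inversion -/

/-- **Self-bounding inversion (the empirical event implies the oracle event).**  For `c ≥ 0` and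
`m̂ ≥ 0`: if `m̂ + √(2 c m̂) + 2 c ≤ m` then `m̂ + √(2 c m) ≤ m`.  (Write `m − m̂ = √(2cm̂) + 2c + e`
with `e ≥ 0` and square: `(m − m̂)² − 2cm = e² + 2(c + e)√(2cm̂) + 2ce ≥ 0`.) [ours] -/
theorem add_sqrt_mul_le_of_add_selfRadius_le {c mhat m : ℝ} (hc : 0 ≤ c) (hmhat : 0 ≤ mhat)
    (h : mhat + Real.sqrt (2 * c * mhat) + 2 * c ≤ m) : mhat + Real.sqrt (2 * c * m) ≤ m := by
  set r : ℝ := Real.sqrt (2 * c * mhat) with hr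
  have hr0 : 0 ≤ r := Real.sqrt_nonneg _
  have hr2 : r ^ 2 = 2 * c * mhat := Real.sq_sqrt (by positivity)
  have hR : 0 ≤ m - mhat := by linarith
  suffices hs : Real.sqrt (2 * c * m) ≤ m - mhat by linarith
  rw [Real.sqrt_le_left hR]
  obtain ⟨e, he, hm⟩ : ∃ e : ℝ, 0 ≤ e ∧ m = mhat + r + 2 * c + e :=
    ⟨m - (mhat + r + 2 * c), by linarith, by ring⟩
  rw [hm]
  nlinarith [mul_nonneg hc hr0, mul_nonneg he hr0, mul_nonneg hc he, sq_nonneg e]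

/-- **Contrapositive form.**  For `c, m̂ ≥ 0`: `m < m̂ + √(2 c m)` implies
`m < m̂ + √(2 c m̂) + 2 c` — an oracle radius `√(2cm)` that covers is dominated by the empirical
radius `√(2cm̂) + 2c`. [ours] -/
theorem lt_add_selfRadius_of_lt_add_sqrt_mul {c mhat m : ℝ} (hc : 0 ≤ c) (hmhat : 0 ≤ mhat)
    (h : m < mhat + Real.sqrt (2 * c * m)) : m < mhat + Real.sqrt (2 * c * mhat) + 2 * c :=
  lt_of_not_ge fun h' => (not_le.2 h) (add_sqrt_mul_le_of_add_selfRadius_le hc hmhat h')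

/-! ## §2 Variance-adaptive lower tail for a bounded nonnegative score under model draws -/

/-- **LOWER TAIL WITH THE SELF-BOUNDING VARIANCE PROXY.**  Independent draws `xᵢ` from the model
`q` (`hlaw`), a measurable score `F` with values in `[0, M]`, model mean `m = ∫ F q dμ`; then for
every finite `s` (`n = #s`) and `t ≥ 0`: `P(Σ_{i∈s} F(xᵢ) + n t ≤ n m) ≤ exp(−n t²/(2 M m))`
(Maurer / BLM Ex. 2.9 with `E F(xᵢ)² ≤ M·E F(xᵢ) = M m`; when `M m = 0` the bound reads `1`).
[ours] -/
theorem measureReal_sum_comp_add_le_exp_of_model_draws_var {x : ι → Ω → X} (hind : iIndepFun x P)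
    (hxm : ∀ i, Measurable (x i)) {q : X → ℝ} (hq0 : ∀ y, 0 ≤ q y) (hqm : Measurable q)
    (hlaw : ∀ i, Measure.map (x i) P = μ.withDensity fun y => ENNReal.ofReal (q y)) {F : X → ℝ}
    (hFm : Measurable F) {M : ℝ} (hF : ∀ y, F y ∈ Icc 0 M) {t : ℝ} (ht : 0 ≤ t) (s : Finset ι) :
    P.real {ω | ∑ i ∈ s, F (x i ω) + s.card * t ≤ s.card * ∫ y, F y * q y ∂μ}
      ≤ Real.exp (-(s.card * t ^ 2 / (2 * (M * ∫ y, F y * q y ∂μ)))) := by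
  have hind' : iIndepFun (fun i ω => F (x i ω)) P := hind.comp (fun _ => F) fun _ => hFm
  have hmeas : ∀ i, AEStronglyMeasurable (fun ω => F (x i ω)) P := fun i =>
    (hFm.comp (hxm i)).aestronglyMeasurable
  have hLp : ∀ i, MemLp (fun ω => F (x i ω)) 2 P := fun i =>
    MemLp.of_bound (hmeas i) M (Filter.Eventually.of_forall fun ω => by
      rw [Real.norm_eq_abs, abs_of_nonneg (hF _).1]; exact (hF _).2)
  have h0 : ∀ i, 0 ≤ᵐ[P] fun ω => F (x i ω) := fun i =>
    Filter.Eventually.of_forall fun ω => (hF _).1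
  have hmean : ∀ i, ∫ ω, F (x i ω) ∂P = ∫ y, F y * q y ∂μ := fun i =>
    integral_comp_eq_integral_mul_of_map_eq (hxm i) hq0 hqm (hlaw i) hFm
  have hsq : ∀ i, ∫ ω, F (x i ω) ^ 2 ∂P ≤ M * ∫ y, F y * q y ∂μ := fun i => by
    rw [← hmean i, ← integral_const_mul]
    refine integral_mono (hLp i).integrable_sq (((hLp i).integrable one_le_two).const_mul M)
      fun ω => ?_
    have h1 := hF (x i ω)
    calc F (x i ω) ^ 2 = F (x i ω) * F (x i ω) := sq _
      _ ≤ M * F (x i ω) := mul_le_mul_of_nonneg_right h1.2 h1.1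
  exact Literature.Probability.Moments.measureReal_sum_add_le_card_mul_le_exp_of_sq_le hind' hLp
    h0 (fun i => (hmean i).ge) hsq ht s

/-- **THE EMPIRICAL (SELF-BOUNDED) RADIUS.**  Independent draws `xᵢ` from the model `q`, a
measurable score `F` with values in `[0, M]`, `M > 0`, model mean `m = ∫ F q dμ`, empirical mean
`F̄ = (Σ_{i∈s} F(xᵢ))/n` over a finite `s` with `n = #s ≥ 1`; then for every `a ≥ 0`:
`P( F̄ + √(2 M a F̄) + 2 M a ≤ m ) ≤ e^{−n a}` — that is, `m < F̄ + √(2 M a F̄) + 2 M a` with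
confidence `1 − e^{−na}` (oracle radius `t = √(2 M a m)` in the variance-adaptive tail, then §1).
[ours] -/
theorem measureReal_mean_add_selfRadius_le_exp_of_model_draws {x : ι → Ω → X}
    (hind : iIndepFun x P) (hxm : ∀ i, Measurable (x i)) {q : X → ℝ} (hq0 : ∀ y, 0 ≤ q y)
    (hqm : Measurable q)
    (hlaw : ∀ i, Measure.map (x i) P = μ.withDensity fun y => ENNReal.ofReal (q y)) {F : X → ℝ}
    (hFm : Measurable F) {M : ℝ} (hM : 0 < M) (hF : ∀ y, F y ∈ Icc 0 M) {a : ℝ} (ha : 0 ≤ a)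
    (s : Finset ι) (hs : 0 < s.card) :
    P.real {ω | (∑ i ∈ s, F (x i ω)) / s.card
          + Real.sqrt (2 * (M * a) * ((∑ i ∈ s, F (x i ω)) / s.card)) + 2 * (M * a)
        ≤ ∫ y, F y * q y ∂μ}
      ≤ Real.exp (-(s.card * a)) := by
  have hn : (0 : ℝ) < s.card := by exact_mod_cast hs
  have hm0 : 0 ≤ ∫ y, F y * q y ∂μ := integral_nonneg fun y => mul_nonneg (hF y).1 (hq0 y)
  have hFbar0 : ∀ ω, 0 ≤ (∑ i ∈ s, F (x i ω)) / s.card := fun ω =>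
    div_nonneg (Finset.sum_nonneg fun i _ => (hF _).1) hn.le
  rcases eq_or_lt_of_le hm0 with hm00 | hmpos
  · -- degenerate mean `m = 0`: either `a = 0` (bound `1`) or the event is empty
    rcases eq_or_lt_of_le ha with ha0 | hapos
    · have e1 : Real.exp (-(s.card * a)) = 1 := by
        rw [← ha0, mul_zero, neg_zero, Real.exp_zero]
      rw [e1]
      exact measureReal_le_one
    · have hempty : {ω | (∑ i ∈ s, F (x i ω)) / s.card
            + Real.sqrt (2 * (M * a) * ((∑ i ∈ s, F (x i ω)) / s.card)) + 2 * (M * a)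
          ≤ ∫ y, F y * q y ∂μ} = ∅ := by
        ext ω
        simp only [mem_setOf_eq, mem_empty_iff_false, iff_false, not_le, ← hm00]
        have h1 := hFbar0 ω
        have h2 := Real.sqrt_nonneg (2 * (M * a) * ((∑ i ∈ s, F (x i ω)) / s.card))
        have h3 := mul_pos hM hapos
        linarith
      rw [hempty, measureReal_empty]
      exact (Real.exp_pos _).le
  · -- `m > 0`: the oracle radius `t = √(2 M a m)` gives rate exactly `a`
    have ht0 : 0 ≤ Real.sqrt (2 * (M * a) * ∫ y, F y * q y ∂μ) := Real.sqrt_nonneg _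
    have h := measureReal_sum_comp_add_le_exp_of_model_draws_var hind hxm hq0 hqm hlaw hFm hF ht0 s
    have hexp : Real.exp (-(s.card * Real.sqrt (2 * (M * a) * ∫ y, F y * q y ∂μ) ^ 2
          / (2 * (M * ∫ y, F y * q y ∂μ)))) = Real.exp (-(s.card * a)) := by
      congr 2
      rw [Real.sq_sqrt (by positivity)]
      field_simp
    rw [hexp] at h
    refine (measureReal_mono fun ω hω => ?_).trans h
    simp only [mem_setOf_eq] at hω ⊢
    have key := add_sqrt_mul_le_of_add_selfRadius_le (c := M * a) (by positivity) (hFbar0 ω) hω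
    have e : ∑ i ∈ s, F (x i ω) = s.card * ((∑ i ∈ s, F (x i ω)) / s.card) := by
      field_simp
    rw [e]
    have := mul_le_mul_of_nonneg_left key hn.le
    linarith

/-! ## §3 The three masses of the parity leg with empirical radii -/

omit [MeasurableSpace X] in
/-- `1_E ∈ [0, 1]`. [folklore] -/
private theorem indicator_one_mem_Icc (E : Set X) (y : X) :
    E.indicator (fun _ => (1 : ℝ)) y ∈ Icc (0 : ℝ) 1 := by
  by_cases hy : y ∈ E
  · rw [indicator_of_mem hy]; exact ⟨zero_le_one, le_rfl⟩
  · rw [indicator_of_notMem hy]; exact ⟨le_rfl, zero_le_one⟩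

/-- `∫ 1_E · q dμ = ∫_E q dμ`. [folklore] -/
private theorem integral_indicator_one_mul {q : X → ℝ} {E : Set X} (hE : MeasurableSet E) :
    ∫ y, E.indicator (fun _ => (1 : ℝ)) y * q y ∂μ = ∫ y in E, q y ∂μ := by
  rw [← integral_indicator hE]
  refine integral_congr_ae (Filter.Eventually.of_forall fun y => ?_)
  by_cases hy : y ∈ E
  · simp only [indicator_of_mem hy, one_mul]
  · simp only [indicator_of_notMem hy, zero_mul]

/-- **The MODEL mass of the exceptional set, empirical radius.**  Independent draws `xᵢ` from `q`,
a measurable `E`, failure count `N = Σ_{i∈s} 1_E(xᵢ)`, `n = #s ≥ 1`, `a ≥ 0`: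
`P( N/n + √(2a·N/n) + 2a ≤ q(E) ) ≤ e^{−na}` — `q(E) < p̂ + √(2ap̂) + 2a` (`p̂ = N/n`) with
confidence `1 − e^{−na}`; compare part I's `q(E) < p̂ + √(a/2)` at the same confidence. [ours] -/
theorem modelMass_le_freq_selfRadius_confidence {x : ι → Ω → X} (hind : iIndepFun x P)
    (hxm : ∀ i, Measurable (x i)) {q : X → ℝ} (hq0 : ∀ y, 0 ≤ q y) (hqm : Measurable q)
    (hlaw : ∀ i, Measure.map (x i) P = μ.withDensity fun y => ENNReal.ofReal (q y)) {E : Set X}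
    (hE : MeasurableSet E) {a : ℝ} (ha : 0 ≤ a) (s : Finset ι) (hs : 0 < s.card) :
    P.real {ω | (∑ i ∈ s, E.indicator (fun _ => (1 : ℝ)) (x i ω)) / s.card
          + Real.sqrt (2 * a * ((∑ i ∈ s, E.indicator (fun _ => (1 : ℝ)) (x i ω)) / s.card))
          + 2 * a
        ≤ ∫ y in E, q y ∂μ}
      ≤ Real.exp (-(s.card * a)) := by
  have h := measureReal_mean_add_selfRadius_le_exp_of_model_draws hind hxm hq0 hqm hlaw
    (measurable_const.indicator hE) one_pos (indicator_one_mem_Icc E) ha s hs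
  rw [integral_indicator_one_mul hE, one_mul] at h
  exact h

/-- **The MODEL mass, oracle (known-variance) form.**  Same setting; for `t ≥ 0`:
`P( N + n t ≤ n·q(E) ) ≤ exp(−n t²/(2 q(E)))` — the binomial lower tail at the sub-Gaussian rate
`1/q(E)` (part I: `exp(−2nt²)`). [ours] -/
theorem modelMass_le_freq_confidence_var {x : ι → Ω → X} (hind : iIndepFun x P)
    (hxm : ∀ i, Measurable (x i)) {q : X → ℝ} (hq0 : ∀ y, 0 ≤ q y) (hqm : Measurable q)
    (hlaw : ∀ i, Measure.map (x i) P = μ.withDensity fun y => ENNReal.ofReal (q y)) {E : Set X}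
    (hE : MeasurableSet E) {t : ℝ} (ht : 0 ≤ t) (s : Finset ι) :
    P.real {ω | ∑ i ∈ s, E.indicator (fun _ => (1 : ℝ)) (x i ω) + s.card * t
        ≤ s.card * ∫ y in E, q y ∂μ}
      ≤ Real.exp (-(s.card * t ^ 2 / (2 * ∫ y in E, q y ∂μ))) := by
  have h := measureReal_sum_comp_add_le_exp_of_model_draws_var hind hxm hq0 hqm hlaw
    (measurable_const.indicator hE) (indicator_one_mem_Icc E) ht s
  rw [integral_indicator_one_mul hE, one_mul] at h
  exact h

omit [MeasurableSpace X] in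
/-- The normalised importance weight restricted to `E`, `1_E·w/(Zq)`, lies in `[0, C/Z]` under the
ceiling `w ≤ Cq` (`w ≥ 0`, `q, Z > 0`). [folklore] -/
private theorem indicator_weight_mem_Icc {q w : X → ℝ} (hq0 : ∀ y, 0 < q y) (hw0 : ∀ y, 0 ≤ w y)
    {Z C : ℝ} (hZ : 0 < Z) (hC : ∀ y, w y ≤ C * q y) (E : Set X) (y : X) :
    E.indicator (fun y => w y / (Z * q y)) y ∈ Icc (0 : ℝ) (C / Z) := by
  have hCZ : 0 ≤ C / Z := by
    have := (hw0 y).trans (hC y)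
    exact div_nonneg (nonneg_of_mul_nonneg_left this (hq0 y)) hZ.le
  by_cases hy : y ∈ E
  · rw [indicator_of_mem hy]
    refine ⟨div_nonneg (hw0 y) (mul_pos hZ (hq0 y)).le, ?_⟩
    rw [div_le_div_iff₀ (mul_pos hZ (hq0 y)) hZ]
    calc w y * Z ≤ C * q y * Z := mul_le_mul_of_nonneg_right (hC y) hZ.le
      _ = C * (Z * q y) := by ring
  · rw [indicator_of_notMem hy]; exact ⟨le_rfl, hCZ⟩

/-- `∫ 1_E·w/(Zq) · q dμ = (∫_E w dμ)/Z` (`q > 0`, `Z > 0`). [folklore] -/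
private theorem integral_indicator_weight_mul {q w : X → ℝ} (hq0 : ∀ y, 0 < q y) {Z : ℝ}
    (hZ : 0 < Z) {E : Set X} (hE : MeasurableSet E) :
    ∫ y, E.indicator (fun y => w y / (Z * q y)) y * q y ∂μ = (∫ y in E, w y ∂μ) / Z := by
  rw [← integral_indicator hE, ← integral_div]
  refine integral_congr_ae (Filter.Eventually.of_forall fun y => ?_)
  by_cases hy : y ∈ E
  · simp only [indicator_of_mem hy]
    field_simp [(hq0 y).ne', hZ.ne']
  · simp only [indicator_of_notMem hy, zero_mul, zero_div]

/-- **The TARGET mass of the exceptional set, empirical radius.**  Independent draws `xᵢ` from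
`q > 0`; a target weight `w ≥ 0` (measurable), `Z > 0`, a weight ceiling `w ≤ Cq` with `C > 0`;
a measurable `E`; `Π̂ = Σ_{i∈s} 1_E(xᵢ)·w(xᵢ)/(Z q(xᵢ))` the importance-weighted failure sum,
`n = #s ≥ 1`, `a ≥ 0`.  Then
`P( Π̂/n + √(2 (C/Z) a · Π̂/n) + 2 (C/Z) a ≤ (∫_E w dμ)/Z ) ≤ e^{−na}` — the target mass
`π(E) = ∫_E w/Z` is below `Π̂/n + √(2Wa·Π̂/n) + 2Wa` (`W = C/Z`) with confidence `1 − e^{−na}`;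
part I needs `W√(a/2)`. [ours] -/
theorem targetMass_le_weightedFreq_selfRadius_confidence {x : ι → Ω → X} (hind : iIndepFun x P)
    (hxm : ∀ i, Measurable (x i)) {q : X → ℝ} (hq0 : ∀ y, 0 < q y) (hqm : Measurable q)
    (hlaw : ∀ i, Measure.map (x i) P = μ.withDensity fun y => ENNReal.ofReal (q y)) {w : X → ℝ}
    (hw0 : ∀ y, 0 ≤ w y) (hwm : Measurable w) {Z C : ℝ} (hZ : 0 < Z) (hCpos : 0 < C)
    (hC : ∀ y, w y ≤ C * q y) {E : Set X} (hE : MeasurableSet E) {a : ℝ} (ha : 0 ≤ a)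
    (s : Finset ι) (hs : 0 < s.card) :
    P.real {ω | (∑ i ∈ s, E.indicator (fun y => w y / (Z * q y)) (x i ω)) / s.card
          + Real.sqrt (2 * (C / Z * a)
              * ((∑ i ∈ s, E.indicator (fun y => w y / (Z * q y)) (x i ω)) / s.card))
          + 2 * (C / Z * a)
        ≤ (∫ y in E, w y ∂μ) / Z}
      ≤ Real.exp (-(s.card * a)) := by
  have hFm : Measurable (E.indicator fun y => w y / (Z * q y)) :=
    (hwm.div (measurable_const.mul hqm)).indicator hE
  have h := measureReal_mean_add_selfRadius_le_exp_of_model_draws hind hxm (fun y => (hq0 y).le)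
    hqm hlaw hFm (div_pos hCpos hZ) (indicator_weight_mem_Icc hq0 hw0 hZ hC E) ha s hs
  rw [integral_indicator_weight_mul hq0 hZ hE] at h
  exact h

omit [MeasurableSpace X] in
/-- The squared importance ratio restricted to `E`, `1_E·(p/q)²`, lies in `[0, W²]` under
`0 ≤ p ≤ Wq`, `q > 0`. [folklore] -/
private theorem indicator_sqWeight_mem_Icc {p q : X → ℝ} (hq0 : ∀ y, 0 < q y)
    (hp0 : ∀ y, 0 ≤ p y) {W : ℝ} (hW : ∀ y, p y ≤ W * q y) (E : Set X) (y : X) :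
    E.indicator (fun y => (p y / q y) ^ 2) y ∈ Icc (0 : ℝ) (W ^ 2) := by
  have hr : p y / q y ≤ W := by rw [div_le_iff₀ (hq0 y)]; exact hW y
  have hr0 : 0 ≤ p y / q y := div_nonneg (hp0 y) (hq0 y).le
  by_cases hy : y ∈ E
  · rw [indicator_of_mem hy]
    exact ⟨sq_nonneg _, pow_le_pow_left₀ hr0 hr 2⟩
  · rw [indicator_of_notMem hy]; exact ⟨le_rfl, sq_nonneg _⟩

/-- `∫ 1_E·(p/q)² · q dμ = ∫_E p²/q dμ` (`q > 0`). [folklore] -/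
private theorem integral_indicator_sqWeight_mul {p q : X → ℝ} (hq0 : ∀ y, 0 < q y) {E : Set X}
    (hE : MeasurableSet E) :
    ∫ y, E.indicator (fun y => (p y / q y) ^ 2) y * q y ∂μ = ∫ y in E, p y ^ 2 / q y ∂μ := by
  rw [← integral_indicator hE]
  refine integral_congr_ae (Filter.Eventually.of_forall fun y => ?_)
  by_cases hy : y ∈ E
  · simp only [indicator_of_mem hy]
    field_simp [(hq0 y).ne']
  · simp only [indicator_of_notMem hy, zero_mul]

/-- **The TARGET-WEIGHTED mass of the exceptional set (ESS column), empirical radius.**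
Independent draws `xᵢ` from `q > 0`; a normalised target density `p ≥ 0` (measurable) with a weight
ceiling `p ≤ Wq`, `W > 0`; a measurable `E`; `Σ̂ = Σ_{i∈s} 1_E(xᵢ)(p(xᵢ)/q(xᵢ))²`, `n = #s ≥ 1`,
`a ≥ 0`.  Then `P( Σ̂/n + √(2 W² a · Σ̂/n) + 2 W² a ≤ ∫_E p²/q dμ ) ≤ e^{−na}` — part I needs
`W²√(a/2)`. [ours] -/
theorem sqWeightMass_le_weightedFreq_selfRadius_confidence {x : ι → Ω → X} (hind : iIndepFun x P)
    (hxm : ∀ i, Measurable (x i)) {q : X → ℝ} (hq0 : ∀ y, 0 < q y) (hqm : Measurable q)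
    (hlaw : ∀ i, Measure.map (x i) P = μ.withDensity fun y => ENNReal.ofReal (q y)) {p : X → ℝ}
    (hp0 : ∀ y, 0 ≤ p y) (hpm : Measurable p) {W : ℝ} (hWpos : 0 < W) (hW : ∀ y, p y ≤ W * q y)
    {E : Set X} (hE : MeasurableSet E) {a : ℝ} (ha : 0 ≤ a) (s : Finset ι) (hs : 0 < s.card) :
    P.real {ω | (∑ i ∈ s, E.indicator (fun y => (p y / q y) ^ 2) (x i ω)) / s.card
          + Real.sqrt (2 * (W ^ 2 * a)
              * ((∑ i ∈ s, E.indicator (fun y => (p y / q y) ^ 2) (x i ω)) / s.card))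
          + 2 * (W ^ 2 * a)
        ≤ ∫ y in E, p y ^ 2 / q y ∂μ}
      ≤ Real.exp (-(s.card * a)) := by
  have hFm : Measurable (E.indicator fun y => (p y / q y) ^ 2) :=
    ((hpm.div hqm).pow_const 2).indicator hE
  have h := measureReal_mean_add_selfRadius_le_exp_of_model_draws hind hxm (fun y => (hq0 y).le)
    hqm hlaw hFm (pow_pos hWpos 2) (indicator_sqWeight_mem_Icc hq0 hp0 hW E) ha s hs
  rw [integral_indicator_sqWeight_mul hq0 hE] at h
  exact h

end Summit.Ventures.LatticeQCDFlow.Scoring.ParityLeg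

end
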